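import Summits.QuantumAdvantage.QuantumAdvantage.Theorems.SosSandwichTransferPBPerFamilyFinal
import Summits.QuantumAdvantage.QuantumAdvantage.Theorems.SosSandwichTransferPBLogScaleFinal
import HarnessLib

/-!
# The three re-threaded machine chains of `TransferPB` form a hierarchy: global ⟹ per-family ⟹ machine-scale

Route `SosSandwich` (items stmt-QuantumAdvantage-15237 / 1131), bookkeeping for reviewers and the planner.  The tree now holds
three twins of the nine-level machine reduction of `TransferPB`, with successively WEAKER influence hypotheses:

1. global `AApath` (g9, `…PathBoundChain*.lean`): one pair `(c, C₀)` for all families, all scales;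
2. per family `AApath_{F₀}` (`…PerFamily*.lean`): constants may depend on the family, all scales;
3. machine scale `ScaleBound F₀` (`…LogScale*.lean`): a bound only at the variance scale the greedy machine uses, with a bumped
   error polynomial.

This file proves the two implications between the hypotheses (`pathBoundAt_of_pathBound`, `scaleBound_of_pathBoundAt`), so
that chain 3 subsumes chains 1–2 (`oracleSimulation_of_forall_scaleBound` recovers `OracleSimulation`), and records which
hypothesis is discharged unconditionally for which class (bounded queries: 2, via `pathBoundAt_of_boundedQueries`; `O(log n)`
queries: 3, via `scaleBound_of_logQueries`).  Honest label: bookkeeping (dyadic rounding of `C₀`); nothing new about machines.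
Sources: AaronsonAmbainis2014 Thm. 23 (proof, p. 14), Thm. 26.
-/

-- D-0017: single-conjunct summit ⇒ the duplicate `QuantumAdvantage.QuantumAdvantage` is mandated.
set_option linter.dupNamespace false

noncomputable section

namespace Summit.QuantumAdvantage.QuantumAdvantage.Cruxes.TransferPB.Birth

open Finset MeasureTheory Literature.Computability.Cryptography Literature.Computability.Complexity
  Literature.Computability.QuantumComplexity Literature.Computability.QuantumComplexity.ClassicalSimulation
open Summit.QuantumAdvantage.QuantumAdvantage.Theses.SosSandwich
open scoped ENNReal

namespace SimTreePB

/-- **Global ⟹ per family**: the global path-wise bound specialises to every family. [folklore] -/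
theorem pathBoundAt_of_pathBound
    (hAA : ∃ (c : ℕ) (C₀ : ℝ), 0 < C₀ ∧ ∀ (F : QCircuitFamily cliffordT) (x : List Bool)
      (ρ : List (Fin (numOracleBits F x) × Bool)) (ε : ℝ), 0 < ε →
      ε ≤ boolVariance (restrictPath ρ (acceptPoly F x)) →
        ∃ i : Fin (numOracleBits F x),
          C₀ * (ε / thm23Degree F x) ^ c ≤ influence i (restrictPath ρ (acceptPoly F x)))
    (F₀ : QCircuitFamily cliffordT) :
    ∃ (c : ℕ) (C₀ : ℝ), 0 < C₀ ∧ ∀ (x : List Bool)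
      (ρ : List (Fin (numOracleBits F₀ x) × Bool)) (ε : ℝ), 0 < ε →
      ε ≤ boolVariance (restrictPath ρ (acceptPoly F₀ x)) →
        ∃ i : Fin (numOracleBits F₀ x),
          C₀ * (ε / thm23Degree F₀ x) ^ c ≤ influence i (restrictPath ρ (acceptPoly F₀ x)) := by
  obtain ⟨c, C₀, hC₀, H⟩ := hAA
  exact ⟨c, C₀, hC₀, fun x ρ ε hε hv => H F₀ x ρ ε hε hv⟩

/-- **Per family ⟹ machine scale**: a per-family path-wise bound at all scales gives the machine-scale bound (same error
polynomial `r' = r`, same exponent `c`, dyadic `2^{-k} ≤ C₀`). [cite: AaronsonAmbainis2014, Thm. 23 (proof, p. 14)] -/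
theorem scaleBound_of_pathBoundAt (F₀ : QCircuitFamily cliffordT)
    (hAA : ∃ (c : ℕ) (C₀ : ℝ), 0 < C₀ ∧ ∀ (x : List Bool)
      (ρ : List (Fin (numOracleBits F₀ x) × Bool)) (ε : ℝ), 0 < ε →
      ε ≤ boolVariance (restrictPath ρ (acceptPoly F₀ x)) →
        ∃ i : Fin (numOracleBits F₀ x),
          C₀ * (ε / thm23Degree F₀ x) ^ c ≤ influence i (restrictPath ρ (acceptPoly F₀ x))) :
    ∀ r : Polynomial ℕ, ∃ (r' : Polynomial ℕ) (c k : ℕ), (∀ n, r.eval n ≤ r'.eval n) ∧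
      ∀ (x : List Bool), 1 ≤ x.length → ∀ ρ : List (Fin (numOracleBits F₀ x) × Bool),
        ((1 / 10 : ℝ) ^ 2 * (1 / (((r'.eval x.length : ℕ) : ℝ) + 1)) / 2) / 2 <
            boolVariance (restrictPath ρ (acceptPoly F₀ x)) →
          ∃ i : Fin (numOracleBits F₀ x),
            (1 / 2 ^ k : ℝ) * ((((1 / 10 : ℝ) ^ 2 * (1 / (((r'.eval x.length : ℕ) : ℝ) + 1)) / 2) / 2) /
              thm23Degree F₀ x) ^ c ≤ influence i (restrictPath ρ (acceptPoly F₀ x)) := by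
  obtain ⟨c, C₀, hC₀, H⟩ := hAA
  -- dyadic rounding of the constant: `2^{-k} ≤ C₀`
  obtain ⟨k, hk⟩ := exists_pow_lt_of_lt_one hC₀ (by norm_num : (1 / 2 : ℝ) < 1)
  have hkC : (1 / 2 ^ k : ℝ) ≤ C₀ := by
    have : ((1 / 2 : ℝ)) ^ k = 1 / 2 ^ k := by rw [div_pow, one_pow]
    rw [← this]; exact hk.le
  intro r
  refine ⟨r, c, k, fun n => le_rfl, fun x _ ρ hv => ?_⟩
  obtain ⟨i, hi⟩ := H x ρ _ (by positivity) hv.le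
  exact ⟨i, le_trans (mul_le_mul_of_nonneg_right hkC (by positivity)) hi⟩

/-- **The machine-scale chain subsumes the others**: `OracleSimulation` from a machine-scale bound for every uniform family
(∘ `oracleSimulationSc_of_scaleBound`); with `scaleBound_of_pathBoundAt ∘ pathBoundAt_of_pathBound` this recovers the global and
the per-family chains. [cite: AaronsonAmbainis2014, Thm. 23 (proof, p. 14)] -/
theorem oracleSimulation_of_forall_scaleBound
    (h : ∀ F₀ : QCircuitFamily cliffordT, F₀.IsUniform →
      ∀ r : Polynomial ℕ, ∃ (r' : Polynomial ℕ) (c k : ℕ), (∀ n, r.eval n ≤ r'.eval n) ∧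
      ∀ (x : List Bool), 1 ≤ x.length → ∀ ρ : List (Fin (numOracleBits F₀ x) × Bool),
        ((1 / 10 : ℝ) ^ 2 * (1 / (((r'.eval x.length : ℕ) : ℝ) + 1)) / 2) / 2 <
            boolVariance (restrictPath ρ (acceptPoly F₀ x)) →
          ∃ i : Fin (numOracleBits F₀ x),
            (1 / 2 ^ k : ℝ) * ((((1 / 10 : ℝ) ^ 2 * (1 / (((r'.eval x.length : ℕ) : ℝ) + 1)) / 2) / 2) /
              thm23Degree F₀ x) ^ c ≤ influence i (restrictPath ρ (acceptPoly F₀ x))) :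
    OracleSimulation := by
  intro F hF r
  exact oracleSimulationSc_of_scaleBound F (h F hF) hF r

/-- **The global chain through the machine-scale one** (sanity composition: `AApath → OracleSimulation` recovered).
[cite: AaronsonAmbainis2014, Thm. 23 (proof, p. 14)] -/
theorem oracleSimulation_of_pathBound_via_scale
    (hAA : ∃ (c : ℕ) (C₀ : ℝ), 0 < C₀ ∧ ∀ (F : QCircuitFamily cliffordT) (x : List Bool)
      (ρ : List (Fin (numOracleBits F x) × Bool)) (ε : ℝ), 0 < ε →
      ε ≤ boolVariance (restrictPath ρ (acceptPoly F x)) →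
        ∃ i : Fin (numOracleBits F x),
          C₀ * (ε / thm23Degree F x) ^ c ≤ influence i (restrictPath ρ (acceptPoly F x))) :
    OracleSimulation :=
  oracleSimulation_of_forall_scaleBound fun F₀ _ => scaleBound_of_pathBoundAt F₀ (pathBoundAt_of_pathBound hAA F₀)

end SimTreePB

end Summit.QuantumAdvantage.QuantumAdvantage.Cruxes.TransferPB.Birth

end
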